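import Summits.NavierStokesRegularity.NavierStokesRegularity.Theses.AngularGalerkinLadder
import Summits.NavierStokesRegularity.NavierStokesRegularity.Theorems.NoOverheating.Negative.LadderLimitExposed
import Literature.Analysis.FluidPDE.ClassicalSolutionCalculus
import HarnessLib

/-!
# KJ-70 — Window slices SELF-SIMILAR under one contraction with ANY amplitude factor (every degree
# of homogeneity at once) are excluded, exactly and asymptotically (route `AngularGalerkinLadder`,
# cruxes K1 `RungBlowupCofinal` / K2 `NoOverheating`; refuter lineage, Negative lane)

Stratum (S30), completing (S27)/(S29) (degree `−1`): a slice `w` with `μ w(λ₀ x) = w(x)` for ONE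
contraction `λ₀ ∈ (0, 1)` and ANY real amplitude factor `μ` — homogeneity of degree `−α` is
`μ = λ₀^{α}`; `μ = λ₀` is (S29), `μ = 1` is dilation invariance (conical / purely angular profiles
`W(x/‖x‖)`), `μ > 1` is growth at the origin
— vanishes as soon as it is continuous at the origin AND has the Type-I spatial decay
`‖w(x)‖ ≤ C/(‖x‖ + 1)` (`eq_zero_of_selfSimilarSlice`):
* `0 < μ < 1`: contract into the origin, `w(x) = μᵏ w(λ₀ᵏ x) → 0 · w(0)`;
* `1 ≤ μ`: expand to infinity, `w(λ₀^{−k} x) = μᵏ w(x)` has norm `≥ ‖w(x)‖` but tends to `0` by the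
  decay (`x ≠ 0`); the origin then follows by continuity;
* `μ ≤ 0`: `μ = 0` is immediate, and `μ < 0` reduces to `(μ², λ₀²)`.
Rung profiles and ladder limits have both properties (classical / continuous; `HasTypeIDecay` at
`t = −1`).  Hence

* PROFILE-level (any `C₀`, rotation, factor): `rungProfile_windowSlice_eq_zero_of_selfSimilar`
  (the window slice `u(−1, ·)` vanishes), `no_windowProfile_selfSimilarSlice` (K2 windows);
* SEQUENCE-level (any `C₀`, rotations, window): no admissible window sequence has window slices
  ASYMPTOTICALLY self-similar under one contraction with any amplitude,
  `μ uₙ(−1, λ₀ x) − uₙ(−1, x) → 0` pointwise (`no_windowSequence_asymptoticallySelfSimilarSlice`).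

READING FOR THE CIRCUIT: no discrete spatial self-similarity OF ANY DEGREE is available to the
window slice of a K2 supply — neither Landau-type (`|x|⁻¹`), nor conical (degree `0`), nor any
other power law under a single contraction.  No `kit`.
[cite: KochNadirashviliSereginSverak2009, Lemma 6.1 (limits of rescaled solutions)] -/

namespace Summit.NavierStokesRegularity.AngularGalerkinLadderSelfSimilarSlicesExcluded

open Set Filter MeasureTheory Topology Function
open Literature.Analysis Literature.Analysis.FluidPDE
open Summit.NavierStokesRegularity.FluidComputer
open Summit.NavierStokesRegularity.FluidComputer.AngularLadder
open Summit.NavierStokesRegularity.NavierStokesRegularity.Theses.AngularGalerkinLadder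
open Summit.NavierStokesRegularity.AngularGalerkinLadderLadderLimit

/-! ## §1 The kinematic lemma -/

/-- Iterating `μ • w (λ₀ • x) = w x`: `μᵏ • w (λ₀ᵏ • x) = w x`. -/
theorem iterate_selfSimilar {w : EuclideanSpace ℝ (Fin 3) → EuclideanSpace ℝ (Fin 3)} {lam μ : ℝ}
    (hss : ∀ x, μ • w (lam • x) = w x) : ∀ (k : ℕ) (x), μ ^ k • w (lam ^ k • x) = w x := by
  intro k
  induction k with
  | zero => intro x; simp
  | succ k ih =>
      intro x
      have h := ih x
      rw [← hss (lam ^ k • x), smul_smul, smul_smul, ← pow_succ, ← pow_succ'] at h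
      rwa [pow_succ' lam] at h ⊢

/-- **Self-similar under one contraction with a POSITIVE amplitude ⇒ zero**, given continuity at
the origin and the decay `‖w x‖ ≤ C/(‖x‖ + 1)`. [folklore] -/
theorem eq_zero_of_selfSimilarSlice_pos {w : EuclideanSpace ℝ (Fin 3) → EuclideanSpace ℝ (Fin 3)}
    {C : ℝ} (hw : ContinuousAt w 0) (hdec : ∀ x, ‖w x‖ ≤ C / (‖x‖ + 1)) {lam μ : ℝ}
    (h0 : 0 < lam) (h1 : lam < 1) (hμ : 0 < μ) (hss : ∀ x, μ • w (lam • x) = w x) :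
    ∀ x, w x = 0 := by
  have hiter := iterate_selfSimilar hss
  have hpow : Tendsto (fun k : ℕ => lam ^ k) atTop (𝓝 0) :=
    tendsto_pow_atTop_nhds_zero_of_lt_one h0.le h1
  -- points off the origin
  have hx : ∀ x, x ≠ 0 → w x = 0 := by
    intro x hx0
    rcases lt_or_ge μ 1 with hμ1 | hμ1
    · -- contract into the origin
      have hwx : Tendsto (fun k : ℕ => w (lam ^ k • x)) atTop (𝓝 (w 0)) :=
        hw.tendsto.comp (by simpa using hpow.smul_const x)
      have hlim : Tendsto (fun k : ℕ => μ ^ k • w (lam ^ k • x)) atTop (𝓝 0) := by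
        simpa using (tendsto_pow_atTop_nhds_zero_of_lt_one hμ.le hμ1).smul hwx
      have hconst : Tendsto (fun k : ℕ => μ ^ k • w (lam ^ k • x)) atTop (𝓝 (w x)) := by
        rw [show (fun k : ℕ => μ ^ k • w (lam ^ k • x)) = fun _ => w x from
          funext fun k => hiter k x]
        exact tendsto_const_nhds
      exact tendsto_nhds_unique hconst hlim
    · -- expand to infinity
      have hout : ∀ k : ℕ, w (lam⁻¹ ^ k • x) = μ ^ k • w x := by
        intro k
        have h := hiter k (lam⁻¹ ^ k • x)
        rw [smul_smul, ← mul_pow, mul_inv_cancel₀ h0.ne', one_pow, one_smul] at h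
        exact h.symm
      have hge : ∀ k : ℕ, ‖w x‖ ≤ ‖w (lam⁻¹ ^ k • x)‖ := by
        intro k
        rw [hout k, norm_smul, Real.norm_of_nonneg (pow_nonneg hμ.le k)]
        exact le_mul_of_one_le_left (norm_nonneg _) (one_le_pow₀ hμ1)
      have hC : 0 ≤ C := by
        have h := (norm_nonneg _).trans (hdec 0)
        rw [norm_zero, zero_add, div_one] at h
        exact h
      -- the decay bound along `λ₀^{-k} x → ∞` tends to `0`
      have hnorm : Tendsto (fun k : ℕ => ‖lam⁻¹ ^ k • x‖ + 1) atTop atTop := by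
        have h2 : Tendsto (fun k : ℕ => lam⁻¹ ^ k) atTop atTop :=
          tendsto_pow_atTop_atTop_of_one_lt (one_lt_inv_iff₀.2 ⟨h0, h1⟩)
        have h3 : Tendsto (fun k : ℕ => lam⁻¹ ^ k * ‖x‖) atTop atTop :=
          h2.atTop_mul_const (norm_pos_iff.2 hx0)
        refine tendsto_atTop_add_const_right _ 1 (h3.congr fun k => ?_)
        rw [norm_smul, norm_pow, norm_inv, Real.norm_of_nonneg h0.le]
      have hbd : Tendsto (fun k : ℕ => C / (‖lam⁻¹ ^ k • x‖ + 1)) atTop (𝓝 0) :=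
        hnorm.const_div_atTop C
      have hle : ‖w x‖ ≤ 0 :=
        ge_of_tendsto' hbd fun k => (hge k).trans (hdec _)
      exact norm_eq_zero.1 (le_antisymm hle (norm_nonneg _))
  -- the origin, by continuity along `λ₀ᵏ • e₀ → 0`
  intro x
  by_cases hx0 : x ≠ 0
  · exact hx x hx0
  push Not at hx0
  subst hx0
  set e₀ : EuclideanSpace ℝ (Fin 3) := EuclideanSpace.single 0 1 with he₀
  have he : e₀ ≠ 0 := by
    intro h
    have h1 : ‖e₀‖ = 1 := by simp [he₀]
    rw [h, norm_zero] at h1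
    exact zero_ne_one h1
  have hseq : Tendsto (fun k : ℕ => w (lam ^ k • e₀)) atTop (𝓝 (w 0)) :=
    hw.tendsto.comp (by simpa using hpow.smul_const e₀)
  have hzero : (fun k : ℕ => w (lam ^ k • e₀)) = fun _ => 0 :=
    funext fun k => hx _ (smul_ne_zero (pow_ne_zero k h0.ne') he)
  rw [hzero] at hseq
  exact tendsto_nhds_unique hseq tendsto_const_nhds

/-- **Self-similar under one contraction with ANY real amplitude ⇒ zero** (`μ = 0` immediate;
`μ < 0` reduces to `(μ², λ₀²)`), given continuity at the origin and `‖w x‖ ≤ C/(‖x‖ + 1)`.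
[folklore] -/
theorem eq_zero_of_selfSimilarSlice {w : EuclideanSpace ℝ (Fin 3) → EuclideanSpace ℝ (Fin 3)}
    {C : ℝ} (hw : ContinuousAt w 0) (hdec : ∀ x, ‖w x‖ ≤ C / (‖x‖ + 1)) {lam : ℝ} (h0 : 0 < lam)
    (h1 : lam < 1) (μ : ℝ) (hss : ∀ x, μ • w (lam • x) = w x) : ∀ x, w x = 0 := by
  rcases eq_or_ne μ 0 with hμ0 | hμ0
  · intro x; rw [← hss x, hμ0, zero_smul]
  have h2 : ∀ x, μ ^ 2 • w (lam ^ 2 • x) = w x := iterate_selfSimilar hss 2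
  have hμ2 : 0 < μ ^ 2 := by rw [pow_two]; exact mul_self_pos.2 hμ0
  exact eq_zero_of_selfSimilarSlice_pos hw hdec (pow_pos h0 2) (pow_lt_one₀ h0.le h1 two_ne_zero)
    hμ2 h2

/-! ## §2 (S30) PROFILE-level -/

section Profile

variable {L : ℕ} {C₀ c : ℝ} {R : EuclideanSpace ℝ (Fin 3) ≃ₗᵢ[ℝ] EuclideanSpace ℝ (Fin 3)}
  {u : ℝ → EuclideanSpace ℝ (Fin 3) → EuclideanSpace ℝ (Fin 3)}
  {p : ℝ → EuclideanSpace ℝ (Fin 3) → ℝ}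
  {d : ℝ → EuclideanSpace ℝ (Fin 3) → EuclideanSpace ℝ (Fin 3)}

/-- Type-I decay at the window time `t = −1`: `‖u(−1, x)‖ ≤ C/(‖x‖ + 1)`. -/
theorem hasTypeIDecay_windowSlice {C : ℝ} (hTI : HasTypeIDecay C u) :
    ∀ x, ‖u (-1) x‖ ≤ C / (‖x‖ + 1) := fun x => by
  simpa using hTI (-1) (by norm_num) x

/-- **(S30) A rung profile's window slice self-similar under one contraction (any amplitude) is
zero** — ANY `C₀`, ANY rotation, ANY factor. -/
theorem rungProfile_windowSlice_eq_zero_of_selfSimilar (hP : IsRungProfile L C₀ c R u p d)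
    {lam : ℝ} (h0 : 0 < lam) (h1 : lam < 1) (μ : ℝ)
    (hss : ∀ x, μ • u (-1) (lam • x) = u (-1) x) : ∀ x, u (-1) x = 0 :=
  eq_zero_of_selfSimilarSlice
    (continuous_slice_of_continuousOn_Iio hP.classical.smooth_velocity.continuousOn
      (by norm_num : (-1 : ℝ) < 0)).continuousAt
    (hasTypeIDecay_windowSlice hP.hasTypeIDecay) h0 h1 μ hss

/-- **(S30) for K2's windows**: no window profile (`0 < δ`) has a window slice self-similar under
one contraction with any amplitude — ANY `C₀`, ANY window, ANY rotation. -/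
theorem no_windowProfile_selfSimilarSlice {cmin cmax δ ε : ℝ} (hδ : 0 < δ)
    (hW : IsWindowProfile L C₀ cmin cmax δ ε c R u p d) {lam : ℝ} (h0 : 0 < lam) (h1 : lam < 1)
    (μ : ℝ) (hss : ∀ x, μ • u (-1) (lam • x) = u (-1) x) : False := by
  obtain ⟨hP, -, -, ⟨x₀, hx₀⟩, -⟩ := hW
  rw [rungProfile_windowSlice_eq_zero_of_selfSimilar hP h0 h1 μ hss x₀, norm_zero] at hx₀
  exact absurd hx₀ (not_le.2 hδ)

end Profile

/-! ## §3 (S30) SEQUENCE-level -/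

variable {C₀ cmin cmax δ : ℝ} {L : ℕ → ℕ} {ε c : ℕ → ℝ}
  {R : ℕ → (EuclideanSpace ℝ (Fin 3) ≃ₗᵢ[ℝ] EuclideanSpace ℝ (Fin 3))}
  {u : ℕ → ℝ → EuclideanSpace ℝ (Fin 3) → EuclideanSpace ℝ (Fin 3)}
  {p : ℕ → ℝ → EuclideanSpace ℝ (Fin 3) → ℝ}
  {d : ℕ → ℝ → EuclideanSpace ℝ (Fin 3) → EuclideanSpace ℝ (Fin 3)}

/-- **(S30) No admissible window sequence has window slices asymptotically self-similar under one
contraction with any amplitude.**  `1 < cmin`, `0 < δ`, `εₙ → 0`, window rung profiles with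
constant `C₀` — ANY `C₀`, ANY rotations, ANY window — and `μ uₙ(−1, λ₀ x) − uₙ(−1, x) → 0`
pointwise for ONE `λ₀ ∈ (0, 1)` and one `μ ∈ ℝ` are contradictory (Type-I ladder limit: window
slice continuous, with Type-I decay, self-similar, hence zero, against the inherited floor).
[cite: KochNadirashviliSereginSverak2009, Lemma 6.1 (limits of rescaled solutions)] -/
theorem no_windowSequence_asymptoticallySelfSimilarSlice (hcmin : 1 < cmin) (hδ : 0 < δ)
    (hε : Tendsto ε atTop (𝓝 0))
    (hW : ∀ n, IsWindowProfile (L n) C₀ cmin cmax δ (ε n) (c n) (R n) (u n) (p n) (d n))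
    {lam : ℝ} (h0 : 0 < lam) (h1 : lam < 1) (μ : ℝ)
    (hdef : ∀ x, Tendsto (fun n => μ • u n (-1) (lam • x) - u n (-1) x) atTop (𝓝 0)) :
    False := by
  obtain ⟨φ, c', R', v, hφ, -, -, -, hptw, -, hvcont, -, -, -, -, hTI, ⟨x₀, hx₀⟩, -⟩ :=
    exists_ladderLimit_typeI hcmin hδ hε hW
  have hss : ∀ x, μ • v (-1) (lam • x) = v (-1) x := by
    intro x
    have h2 : Tendsto (fun n => μ • u (φ n) (-1) (lam • x) - u (φ n) (-1) x) atTop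
        (𝓝 (μ • v (-1) (lam • x) - v (-1) x)) :=
      ((hptw (-1) (by norm_num) (lam • x)).const_smul μ).sub (hptw (-1) (by norm_num) x)
    exact sub_eq_zero.1 (tendsto_nhds_unique h2 ((hdef x).comp hφ.tendsto_atTop))
  have hz := eq_zero_of_selfSimilarSlice
    (continuous_slice_of_continuousOn_Iio hvcont (by norm_num : (-1 : ℝ) < 0)).continuousAt
    (fun x => by simpa using hTI (-1) (by norm_num) x) h0 h1 μ hss
  rw [hz x₀, norm_zero] at hx₀
  exact absurd hx₀ (not_le.2 hδ)

/-- **(S30) in census form.** -/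
theorem no_windowSequence_asymptoticallySelfSimilarSlice_census (hcmin : 1 < cmin) (hδ : 0 < δ)
    (hε : Tendsto ε atTop (𝓝 0))
    (hW : ∀ n, IsWindowProfile (L n) C₀ cmin cmax δ (ε n) (c n) (R n) (u n) (p n) (d n)) :
    ¬ ∃ lam μ : ℝ, 0 < lam ∧ lam < 1 ∧
        ∀ x, Tendsto (fun n => μ • u n (-1) (lam • x) - u n (-1) x) atTop (𝓝 0) :=
  fun ⟨_, μ, h0, h1, hdef⟩ =>
    no_windowSequence_asymptoticallySelfSimilarSlice hcmin hδ hε hW h0 h1 μ hdef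

end Summit.NavierStokesRegularity.AngularGalerkinLadderSelfSimilarSlicesExcluded
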